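import Literature.NumberTheory.Automorphic.Liu2021.AppendixBPolesThetaLifting
import Literature.NumberTheory.Automorphic.AutomorphicSpectrum
import Literature.NumberTheory.Automorphic.IdeleClassCharacterConjugate
import Literature.NumberTheory.GaloisRepresentations.HeckeCharacter
import HarnessLib

/-!
# Liu 2021, Appendix B «Poles of Eisenstein series and theta lifting for unitary groups» (print pp. 95–106):
# the statements B.1–B.12 AS PRINTED — carpet (statements only), completing ★ `AppendixBPolesThetaLifting`

Source: Y. Liu, *Fourier–Jacobi cycles and arithmetic relative trace formula (with an appendix by C. Li and
Y. Zhu)*, Camb. J. Math. **9** (2021), no. 1, 1–147 [Liu2021]; print pages from the held journal text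
(`paper:liu2021-fourier-jacobi-cycles-arithmetic-relative-trace-formula`, page file = journal page); second
locator = TeX of record `FJcycle.tex` (md5 6db49a74…), App. B = `\label{ss:b}`, l. 4218–4543.  Appendix B is
used in [Liu2021] only in the proof of Prop. 4.13 (l. 4221; proof of Prop. 4.13, p. 48: Cor. B.5, Thm. B.4,
Cor. B.6 (1)(2)(3)).

STATEMENT-ONLY CARPET (squad TL «Liu FJ∕418», seat TL-t08; TYPER LINT RULE): named notions with bodies and
named statements `def … : Prop`, each with a cite docstring (bib key, item as numbered in print, journal page); no proofs
(TYPER LINT RULE).  NOTHING IS ASSERTED by the dictionary predicates of §§ 2–3 below: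
exactly as in ★ `AppendixBPolesThetaLifting` (whose `ThetaPoleDictionary` this file EXTENDS), the automorphic
objects the printed statements quantify over — Eisenstein series on the tower `G_a = U(V ⊕ (δ_a⁺ ⊕ δ_a⁻))`,
their sets of positive real poles `Pol_a(V_π ⊠ μᶜ)`, the residual spaces `R_s(V_π ⊠ μᶜ)`, the Siegel–hermitian
Eisenstein series `E_{P_a}(·; f^◇_{a,s})` of the doubling space `V^◇_a`, the pull-backs `f^{◇,φ}_{a,s}` — have no
Mathlib∕tree currency (no Eisenstein series on unitary groups of rank `≥ 2`, no regularised Siegel–Weil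
formula; census `F0/P2/T5b-TREE.md`), so they are POSITED as the fields (types ∕ functions ∕ relations, NO
propositional field) of ONE interface `ThetaPoleProofDictionary extends ThetaPoleDictionary`, and every printed
statement is a predicate `def … (X : ThetaPoleProofDictionary) : Prop` = a VERBATIM reading with locator
(class **P**); a consumer supplies the dictionary from its own model and takes `(h : X.CorB6_2)` etc. as
explicit hypotheses — never `∀ X, …`, which would be junk.  Class **D** = a definition read off the print
(`IsLargestPole`, `PolOneSpec`, `HasParity`).  Nothing here is class K (no proofs in a carpet).

## INDEX (print numbering = TeX counter; p. = journal page of the item's first line)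

| item | content | Lean |
|---|---|---|
| §B.1 set-up (p. 95–96; l. 4226–4230) | `L²(G(F)\G(𝔸_F), χ)`, `L²_disc(G) = ⊕_χ L²_disc(…, χ)`, `L²_cusp(G)` | ★ `AdelicGroupData.rightRegular`, ★ `AdelicGroupData.discreteSpectrum`, ★ `CuspidalSpectrumData` (`AutomorphicSpectrum`) — see «Transcription of Def. B.1» |
| **Def. B.1** (p. 96 L14; l. 4232–4239) | (1) `m_disc(π)`, `m_cusp(π)`; (2) discrete ∕ cuspidal realization `V_π` | REAL: `discMultiplicity`, `cuspMultiplicity`, `DiscreteRealization`, `DiscreteRealization.IsCuspidal` (§1) |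
| sentence p. 96 L20 (l. 4241) | «It is known that `0 ≤ m_cusp(π) ≤ m_disc(π) < ∞`» | `cuspMultiplicity_le_discMultiplicity` (named fact); «`< ∞`» = ★ `multiplicity_lt_top_of_mem_discreteSpectrum` (hypothesis predicate, `AutomorphicSpectrum`) |
| **Def. B.2** (p. 96 L25; l. 4249–4251) | strictly unitary automorphic character | ★ `IdeleClassGroup.IsStrictlyUnitary` (`IdeleClassCharacterConjugate`, for unitary `C_E →ₜ* S¹`); for QUASI-characters `𝕀_E → ℂˣ` as printed: `IsStrictlyUnitaryQuasi` (§1) |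
| **Rem. B.3** (p. 96 L37; l. 4253–4255) | strictly unitary ⇒ unitary; `∃! s`, `μ|·|_E^s` strictly unitary | `remB3_isUnitary`, `remB3_existsUnique_twist` (named facts, REAL over ★ `HeckeCharacter` ∕ `ideleNorm` ∕ `posRealIdele`) |
| Rem. after Def. 4.1 (p. 41; l. 1904–1906) | conjugate self-dual ⇒ strictly unitary | ★ `IdeleClassGroup.IsConjugateSelfDual.isStrictlyUnitary` (PROVED, `IdeleClassCharacterConjugate`) |
| §B.2 set-up (p. 96–97; l. 4257–4275) | `V`, `W`, `G = U(V)`, `H = U(W)`, `ω^{V,W}_μ`, `Θ^W_{μ,V}`, `L^S(s, π × μ)`, `E_Q(g; f_s)`, convention l. 4274 | ★ `ThetaPoleDictionary` fields + ★ `ThetaPoleDictionary.Convention` |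
| **Thm. B.4** (p. 98 L14; l. 4278–4297) | (1) (a) ⇒ (b) ⇒ (c); (2) `W` unique | ★ `ThetaPoleDictionary.ThmB4_1`, ★ `ThetaPoleDictionary.ThmB4_2` |
| **Cor. B.5** (p. 98 L37; l. 4301–4314) | location of the poles `Pol^S_{π,μ}` | ★ `ThetaPoleDictionary.CorB5` (+ ★ `corB5_of_thmB4`, proved there) |
| paragraph p. 98 L52 (l. 4317) | «largest pole at `s_max`», the `W` of dimension `n + 1 − 2 s_max` | `IsLargestPole` (D), `PolOneSpec` (D) |
| **Cor. B.6** (p. 99 L5; l. 4319–4335) | (1) `Θ^W(V_π)` irreducible, (B.2); (2) `R_{s_max}` irreducible, (B.3); (3) `m_cusp(π) = 1` ∕ `m_cusp(π₁) = 0` | (1) ★ `ThetaPoleDictionary.CorB6_1`; (2) `CorB6_2`; (3) `CorB6_3_cusp`, `CorB6_3_res` |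
| **Rem. B.7** (p. 100 L22; l. 4351–4353) | `Θ^W(V_π)` is always cuspidal (exercise, after [GJS09, Thm. 5.1]) | `RemB7` |
| §B.3 notation (p. 100 L41 – p. 101 L3; l. 4372) | `δ^±_a`, `V_a`, `G_a`, `Q_a`, `I_a(V_π ⊠ μᶜ)`, `E_{Q_a}`, `Pol_a(V_π ⊠ μᶜ)`, `I_1 = I` | fields `Pol`, `GaPts`; `PolOneSpec` (D) |
| **Prop. B.8** (p. 100 L29; l. 4361–4368) | (1) `W` of dimension `n + 1 − 2 s₁` with `Θ^W(V_π) ≠ 0`; (2) other positive real poles `= s₁ − j` | `PropB8_1`, `PropB8_2` |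
| **Lem. B.9** (p. 101 L5; l. 4374–4376) | `s₀ + (a−1)/2 ∈ Pol_a` | `LemB9` |
| doubling set-up (p. 101 L13 – L52; l. 4382–4396) | `V^◇_a`, `ι : G_a × G → U(V^◇_a)`, `P_a`, `J_a(s, μᶜ)`, `f^◇_{a,s}`, `E_{P_a}`, (B.4) `f^{◇,φ}_{a,s}` | fields `StdSection`, `Form`, `SiegelEisPole`, `SiegelEisPoleSimple`, `PullbackConverges`, `PullbackMeromorphic`, `PullbackPole`, `PullbackIsSection`, `doublingIntegral`, `eisQPullback`, `PullbacksSpan` |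
| **Lem. B.10** (p. 101 L56; l. 4398–4409) | (1) poles of `E_{P_a}` simple, `⊆ {(n+a−i)/2 − k}`; (2) convergence for `Re s > (n+a)/2`; (3) continuation, poles `⊆ {(n−i)/2 − k}`; (4) section of `Ind` | `LemB10_1`, `LemB10_2`, `LemB10_3`, `LemB10_4` (`HasParity` (D) = «`μ|𝔸_F^× = μ_{E/F}^i`, `i ∈ {0,1}`») |
| **Lem. B.11** (p. 102 L37; l. 4417–4423) | `∫_{[G]} E_{P_a}(ι(g′,g); f^◇_{a,s}) φ(g) μ(det g) dg = E_{Q_a}(g′; f^{◇,φ}_{a,s})` | `LemB11` |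
| **Lem. B.12** (p. 103 L77; l. 4456–4458) | `∃ a₀`, for `a ≥ a₀` the `f^{◇,φ}_{a,s}` span `Ind` away from poles | `LemB12` |
| proofs (§B.3, pp. 100–106; l. 4465–4541) | proof of Prop. B.8 and of Thm. B.4 | NOT typed (inputs: [Tan99] Main Thm, [Mœg97] §2.1, [GJS09] §3, [KS97]∕[Lee94], [Ich04], [HKS96, Lem. 1.1], [Kim99, Cor. 2.2], [SZ15, Thm. 1.10], [Wu13, Thm. 5.1∕5.3, Prop. 5.9], [GT16, Thm. 1.2]) |

## Transcription of Def. B.1 (what is real, what is special-cased)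

Liu's `L²_disc(G) := ⊕_χ L²_disc(G(F)\G(𝔸_F), χ)` runs over ALL automorphic characters `χ` of `Z_G(𝔸_F)` (functions
transforming by `χ` under the centre, square-integrable modulo centre after a unitarising twist, l. 4226).  The
tree's honest `L²` object is ★ `AdelicGroupData.rightRegular 𝒢 μ` on `L²(G(𝔸_K) ⧸ A_G·G(K), μ)` with its discrete part
★ `discreteSpectrum` and cuspidal data ★ `CuspidalSpectrumData` (`AutomorphicSpectrum`).  For a group with
ANISOTROPIC centre — the only case [Liu2021] uses: `G = U(V)`, `Z_G = U(1)_{E/F}`, `A_G = 1`, `Z_G(F)\Z_G(𝔸_F)` compact —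
`L²(G(F)\G(𝔸_F))` is the Hilbert sum over the characters `χ` of the compact group `Z_G(F)\Z_G(𝔸_F)` of its `χ`-parts
`L²(G(F)\G(𝔸_F), χ)`, so Liu's `m_disc(π)` ∕ `m_cusp(π)` are the multiplicities of `π` in the tree's `L²_disc` ∕ `L²_cusp`,
which is what `discMultiplicity` ∕ `cuspMultiplicity` say (★ `ContRepresentation.multiplicity` = sup of sizes of orthogonal
families of irreducible closed subrepresentations unitarily equivalent to `π` = `dim Hom(π, L²_disc)` when finite, by Schur);
«isomorphic to `π`» is read as unitary equivalence of the Hilbert completions (★ `AreUnitarilyEquivalent`).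
-- TODO(general form): for `G` with non-compact centre (e.g. `GL_n`) Liu's `m_disc(π)` also counts realizations with
-- central character non-trivial on `A_G`; that needs the `χ`-twisted spaces `L²(G(F)\G(𝔸_F), χ)`, not in the tree.

HC_CM is proved only modulo the 7 printed citations (2 remaining: hLiu418, h413) until rung 0 closes; nothing asserted here.

## References
* [Liu2021] Y. Liu, Camb. J. Math. 9 (2021) 1–147, App. B pp. 95–106 (TeX l. 4218–4543); Def. 4.1 + Remark p. 41 (l. 1900–1906).
* [GinzburgJiangSoudry2009] Ginzburg–Jiang–Soudry, J. Inst. Math. Jussieu 8 (2009) 693–741 (strategy of §B.3: Thm. 1.1, 3.1,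
  Prop. 1.1, 3.2, 3.3, Thm. 5.1); C. Mœglin, J. Lie Theory 7 (1997) 201–229, Rem. 1.1, §2.1; V. Tan, Canad. J. Math. 51 (1999), Main Thm.
* [Wu2013] C. Wu, J. Number Theory 133 (2013), Thm. 5.1, 5.3, Prop. 5.9; [SunZhu2014] Sun–Zhu, J. AMS 28 (2015), Thm. 1.10;
  Gan–Takeda, J. AMS 29 (2016), Thm. 1.2; [BorelJacquetCorvallis1979] Borel–Jacquet, Corvallis 1979 part 1, §4.6.
-/

noncomputable section

open MeasureTheory
open scoped NNReal ENNReal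

namespace Literature.NumberTheory.Automorphic.Liu2021.AppendixB.PolesEisensteinThetaLifting

universe u v

/-! ## §1. Def. B.1, the multiplicity sentence, Def. B.2 (quasi-characters), Rem. B.3 — REAL objects -/

section DefB1

variable {K : Type} [Field K] [NumberField K]
variable (𝒢 : AdelicGroupData.{u} K) (μ : Measure 𝒢.automorphicQuotient) [𝒢.IsAutomorphicMeasure μ]
variable {H : Type v} [SeminormedAddCommGroup H] [Module ℂ H]

/-- **Definition B.1 (1), discrete multiplicity** `m_disc(π)`: «We define the discrete (resp. cuspidal) multiplicity
`m_disc(π)` (resp. `m_cusp(π)`) of `π` to be the dimension of `Hom_{G(𝔸_F)}(π, L²_disc(G))` (resp. `Hom_{G(𝔸_F)}(π,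
L²_cusp(G))`).»  Transcribed (module docstring «Transcription of Def. B.1») as the multiplicity, in `ℕ∞`, of the
representation `π` of `G(𝔸_K)` in the regular representation ★ `𝒢.rightRegular μ` on `L²(G(𝔸_K) ⧸ A_G G(K), μ)` — every
irreducible closed subrepresentation lies in ★ `discreteSpectrum` (`DiscreteAutomorphicRep.le_discreteSpectrum`), so
this IS the multiplicity in `L²_disc`.  Exact for anisotropic-centre `G` (e.g. `U(V)`); `-- TODO(general form)` above.
[cite: Liu2021, Def. B.1 (1) (p. 96); FJcycle.tex l. 4235] -/
def discMultiplicity (π : ContRepresentation ℂ 𝒢.Adelic H) : ℕ∞ :=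
  (𝒢.rightRegular μ).multiplicity π

/-- **Definition B.1 (1), cuspidal multiplicity** `m_cusp(π)` = «the dimension of `Hom_{G(𝔸_F)}(π, L²_cusp(G))`»: the
multiplicity of `π` in the cuspidal subspace `L²_cusp` of a cuspidal-spectrum datum ★ `𝒞 : CuspidalSpectrumData 𝒢 μ`
(the tree carries `L²_cusp ≤ L²_disc` as a hypothesis structure, instantiated honestly for `GL_n`; for `U(V)` a consumer
supplies the genuine cuspidal subspace). [cite: Liu2021, Def. B.1 (1) (p. 96); FJcycle.tex l. 4235] -/
def cuspMultiplicity (𝒞 : CuspidalSpectrumData 𝒢 μ) (π : ContRepresentation ℂ 𝒢.Adelic H) : ℕ∞ :=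
  𝒞.cusp.toContRep.multiplicity π

/-- **Definition B.1 (2), discrete realization**: «We define a discrete (resp. cuspidal) realization of `π` to be an
irreducible subrepresentation `V_π` contained in `L²_disc(G)` (resp. `L²_cusp(G)`) that is isomorphic to `π`.»  A
discrete realization of the representation `π` of `G(𝔸_K)`: a discrete automorphic representation ★ `DiscreteAutomorphicRep
𝒢 μ` (a topologically irreducible closed invariant subspace of `L²`, automatically `≤ L²_disc`) together with the
WITNESS that it is unitarily equivalent to `π` (★ `ContRepresentation.AreUnitarilyEquivalent`).
[cite: Liu2021, Def. B.1 (2) (p. 96); FJcycle.tex l. 4237] -/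
structure DiscreteRealization (π : ContRepresentation ℂ 𝒢.Adelic H) where
  /-- the irreducible closed invariant subspace `V_π ⊆ L²_disc(G)` -/
  rep : DiscreteAutomorphicRep 𝒢 μ
  /-- `V_π ≅ π` -/
  equiv : ContRepresentation.AreUnitarilyEquivalent rep.space.toContRep π

variable {𝒢 μ}

/-- **Definition B.1 (2), cuspidal realization**: the discrete realization `V_π` is CUSPIDAL for the cuspidal-spectrum
datum `𝒞` when `V_π ⊆ L²_cusp(G)` (★ `DiscreteAutomorphicRep.IsCuspidalFor`). [cite: Liu2021, Def. B.1 (2) (p. 96); FJcycle.tex l. 4237] -/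
def DiscreteRealization.IsCuspidal (𝒞 : CuspidalSpectrumData 𝒢 μ) {π : ContRepresentation ℂ 𝒢.Adelic H}
    (V : DiscreteRealization 𝒢 μ π) : Prop :=
  V.rep.IsCuspidalFor 𝒞

/-- **Definition B.1 (2), realization perpendicular to `L²_cusp`** (used in the proof of Prop. 4.13, Case 2, p. 48 L43:
«Let `V_π` be a discrete realization of `π` that is perpendicular to `L²_cusp(G)`»): `V_π ⟂ L²_cusp`.
[cite: Liu2021, Def. B.1 (2) (p. 96) and proof of Prop. 4.13, Case 2 (p. 48); FJcycle.tex l. 2143] -/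
def DiscreteRealization.IsPerpCuspidal (𝒞 : CuspidalSpectrumData 𝒢 μ) {π : ContRepresentation ℂ 𝒢.Adelic H}
    (V : DiscreteRealization 𝒢 μ π) : Prop :=
  V.rep.space.toSubmodule ⟂ 𝒞.cusp.toSubmodule

end DefB1

/-- **«It is known that `0 ≤ m_cusp(π) ≤ m_disc(π) < ∞`.»** (sentence after Def. B.1), middle inequality, over the real
objects of §1: for every adelic group datum, automorphic measure, cuspidal-spectrum datum `𝒞` (`L²_cusp ≤ L²_disc ≤ L²`) and
representation `π`, `m_cusp(π) ≤ m_disc(π)` (an orthogonal family of irreducible closed subrepresentations of `L²_cusp`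
equivalent to `π` is such a family in `L²`).  The «`< ∞`» part is the finiteness of multiplicities in `L²_disc` for REDUCTIVE
`G` [Borel–Jacquet 1979, §4.6] = the tree's hypothesis predicate ★ `multiplicity_lt_top_of_mem_discreteSpectrum 𝒢 μ`
(`AutomorphicSpectrum`; false for arbitrary data, see its docstring) — cited, not restated; «`0 ≤`» is vacuous in `ℕ∞`.
Named fact (no proof in a carpet). [cite: Liu2021, App. B §B.1, sentence after Def. B.1 (p. 96 L20); FJcycle.tex l. 4241]
[cite: BorelJacquetCorvallis1979, §4.6] -/
def cuspMultiplicity_le_discMultiplicity : Prop :=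
  ∀ {K : Type} [Field K] [NumberField K] (𝒢 : AdelicGroupData.{u} K) (μ : Measure 𝒢.automorphicQuotient)
    [𝒢.IsAutomorphicMeasure μ] (𝒞 : CuspidalSpectrumData 𝒢 μ)
    {H : Type v} [SeminormedAddCommGroup H] [Module ℂ H] (π : ContRepresentation ℂ 𝒢.Adelic H),
    cuspMultiplicity 𝒢 μ 𝒞 π ≤ discMultiplicity 𝒢 μ π

section DefB2

variable (E : Type) [Field E] [NumberField E]

/-- **Definition B.2 (strictly unitary), for QUASI-characters as printed**: «We say that an automorphic character
`μ : E^×\𝔸_E^× → ℂ^×` is strictly unitary if `μ_∞` takes value `1` on the diagonal `Δ^{[F:ℚ]} ℝ^×_{>0} ⊆ (ℝ^×_{>0})^{[F:ℚ]}` as a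
subgroup of `E_∞^× ⊆ 𝔸_E^∞`.»  Here an automorphic character is a ★ `HeckeCharacter E` (continuous `𝕀_E → ℂˣ` trivial on
`E^×`, `GaloisRepresentations/HeckeCharacter`), and the diagonal is the tree's positive real idele ★ `posRealIdele E r`
(`r > 0` at EVERY infinite place of `E`, `1` at the finite places; for `E` CM the infinite places of `E` are the `[F:ℚ]`
complex places, so this is Liu's diagonal).  The tree's ★ `IdeleClassGroup.IsStrictlyUnitary` (`IdeleClassCharacterConjugate`)
is the same condition for UNITARY characters `C_E →ₜ* S¹`; it is cited, not restated — this is the quasi-character form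
Rem. B.3 needs. [cite: Liu2021, Def. B.2 (p. 96 L25); FJcycle.tex l. 4249–4251] -/
def IsStrictlyUnitaryQuasi (μ : GaloisRepresentations.HeckeCharacter E) : Prop :=
  ∀ r : ℝ≥0ˣ, μ (posRealIdele E r) = 1

end DefB2

/-- **Remark B.3, first sentence**: «It is clear that a strictly unitary automorphic character is unitary» (for `E` a CM
field, Liu's standing hypothesis p. 96 L23: `E/F` totally imaginary quadratic over `F` totally real): a Hecke character
of `E` trivial on the positive real diagonal has absolute value `1` (★ `HeckeCharacter.IsUnitary`; reason: `𝕀_E = 𝕀_E¹ ·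
Δℝ_{>0}` and `𝕀_E¹/E^×` is compact).  Named fact. [cite: Liu2021, Rem. B.3 (p. 96 L37); FJcycle.tex l. 4254] -/
def remB3_isUnitary : Prop :=
  ∀ (E : Type) [Field E] [NumberField E] [NumberField.IsCMField E] (μ : GaloisRepresentations.HeckeCharacter E),
    IsStrictlyUnitaryQuasi E μ → μ.IsUnitary

/-- **Remark B.3, second sentence**: «For every automorphic character `μ` of `𝔸_E^×`, there exists a unique complex number
`s` such that `μ|·|_E^s` is strictly unitary.»  Typed on the diagonal itself (strict unitarity only constrains the values
there): there is a unique `s ∈ ℂ` with `μ(z(r)) · ‖z(r)‖_E^s = 1` for all `r > 0`, where `z(r)` = ★ `posRealIdele E r` and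
`‖·‖_E` = ★ `GaloisRepresentations.ideleNorm` (so `‖z(r)‖_E = r^{[E:ℚ]}`; complex power `Complex.cpow` of a positive real).
Named fact. [cite: Liu2021, Rem. B.3 (p. 96 L38–40); FJcycle.tex l. 4254] -/
def remB3_existsUnique_twist : Prop :=
  ∀ (E : Type) [Field E] [NumberField E] [NumberField.IsCMField E] (μ : GaloisRepresentations.HeckeCharacter E),
    ∃! s : ℂ, ∀ r : ℝ≥0ˣ,
      (μ (posRealIdele E r) : ℂ) * ((GaloisRepresentations.ideleNorm (posRealIdele E r) : ℂ) ^ s) = 1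

/-! ## §2. The interface: `ThetaPoleProofDictionary` (posited primitives of §B.2 ¶ p. 98 L52 – §B.3), NO propositional field -/

/-- **Posited primitives** for Cor. B.6 (2)(3), Rem. B.7 and §B.3 of [Liu2021, App. B], EXTENDING ★ `ThetaPoleDictionary`
(which posits, for ONE CM extension `E/F`, ONE hermitian `V` of rank `n`, `G = U(V)` and `ψ_F`: cuspidal realizations
`CuspRep`, strictly unitary characters `Char`, `IsConjOrthogonal` ∕ `IsConjSymplectic`, `HasPole`, `EisPole`, skew-hermitian
classes `SkewHerm` with `dim`, `ThetaNonzero`, `LiftCuspidal`, `LiftIrreducible`, `IsDoubleTheta`, `IsCharacter`).  The new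
fields (types ∕ functions ∕ relations only, NO propositional field; meanings VERBATIM from the print, see each field's
docstring) name: `m_cusp` of the underlying `π` of `V_π` and of the residual `π₁`; the pole sets `Pol_a(V_π ⊠ μᶜ) ⊆ ℝ` of the
Eisenstein series `E_{Q_a}(·; f_{a,s})` on the tower `G_a = U(V ⊕ (δ_a⁺ ⊕ δ_a⁻))`, `Q_a` the parabolic stabilising `δ_a⁺`
(p. 100 L41 – p. 101 L3; `I_1 = I`, `Q_1 = Q`); irreducibility of the residual space `R_s(V_π ⊠ μᶜ)` of `G_1(𝔸_F)` and the
identity (B.3); «`π_W` has a unique realization as a subquotient in the space of automorphic forms on `U(W)`»; the points of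
`G_a(𝔸_F)`, cusp forms `φ ∈ V_π`, standard sections `f^◇_{a,s} ∈ J_a(s, μᶜ) = Ind_{P_a}^{U(V^◇_a)} (μᶜ·|·|^s)∘det_{n+a}` of the
doubling space `V^◇_a = V_a ⊕ (−V)` (p. 101 L13–28); poles ∕ simplicity of the Siegel–hermitian `E_{P_a}(·; f^◇_{a,s})`;
convergence, meromorphy, poles and the section property of the pull-back (B.4) `f^{◇,φ}_{a,s}(g′) = ∫_{G(𝔸_F)} f^◇_{a,s}(ι(g⁻¹g′,
1)) φ(g) dg`; the two sides of the identity of Lem. B.11 as values; the span statement of Lem. B.12.  Nothing is asserted.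
[cite: Liu2021, App. B Def. B.1 (p. 96), Cor. B.6 (p. 99), §B.3 (pp. 100–103); FJcycle.tex l. 4232–4239, 4317–4335, 4372,
4382–4396, 4398–4409, 4417–4423, 4456–4458] -/
structure ThetaPoleProofDictionary extends ThetaPoleDictionary.{u} where
  /-- `m_cusp(π)` of the underlying `π` of the cuspidal realization `V_π` (Def. B.1) -/
  cuspMult : CuspRep → ℕ
  /-- `Pol_a(V_π ⊠ μᶜ) ⊆ ℝ`, positive real poles of `E_{Q_a}(·; f_{a,s})` (§B.3, p. 100–101) -/
  Pol : CuspRep → Char → ℕ → Set ℝ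
  /-- «`R_s(V_π ⊠ μᶜ)` is an irreducible representation of `G_1(𝔸_F)`» (Cor. B.6 (2)) -/
  ResIrreducible : CuspRep → Char → ℝ → Prop
  /-- «`R_s(V_π ⊠ μᶜ) = Θ^{V_1}_{(μ⁻¹,ν⁻¹),−W}(Θ^W_{(μ,ν),V}(V_π))`» ((B.3)) -/
  ResIsThetaLift : CuspRep → Char → ℝ → SkewHerm → Prop
  /-- `m_cusp(π₁)`, `π₁` the underlying irreducible representation of `R_s(V_π ⊠ μᶜ)` (Cor. B.6 (3)) -/
  resCuspMult : CuspRep → Char → ℝ → ℕ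
  /-- «`π_W` has a unique realization as a subquotient in the space of automorphic forms on `U(W)`» (Cor. B.6 (3)) -/
  LiftUniqueRealization : CuspRep → Char → SkewHerm → Prop
  /-- points `g′ ∈ G_a(𝔸_F)`, `G_a = U(V ⊕ (δ_a⁺ ⊕ δ_a⁻))` -/
  GaPts : ℕ → Type u
  /-- cusp forms `φ ∈ V_π` -/
  Form : CuspRep → Type u
  /-- standard sections `f^◇_{a,s} ∈ J_a(s, μᶜ)` (p. 101 L26) -/
  StdSection : Char → ℕ → Type u
  /-- «`E_{P_a}(·; f^◇_{a,s})` has a pole at `s`» -/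
  SiegelEisPole : (μ : Char) → (a : ℕ) → StdSection μ a → ℂ → Prop
  /-- «the pole of `E_{P_a}(·; f^◇_{a,s})` at `s` is simple» -/
  SiegelEisPoleSimple : (μ : Char) → (a : ℕ) → StdSection μ a → ℂ → Prop
  /-- «the integral (B.4) defining `f^{◇,φ}_{a,s}` is absolutely convergent at `s`» -/
  PullbackConverges : (V : CuspRep) → (μ : Char) → (a : ℕ) → StdSection μ a → Form V → ℂ → Prop
  /-- «`f^{◇,φ}_{a,s}` has a meromorphic continuation to the entire complex plane» -/
  PullbackMeromorphic : (V : CuspRep) → (μ : Char) → (a : ℕ) → StdSection μ a → Form V → Prop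
  /-- «`s` is a pole of (the continuation of) `f^{◇,φ}_{a,s}`» -/
  PullbackPole : (V : CuspRep) → (μ : Char) → (a : ℕ) → StdSection μ a → Form V → ℂ → Prop
  /-- «`f^{◇,φ}_{a,s}` is a section in `Ind_{Q_a(𝔸_F)}^{G_a(𝔸_F)} V_π ⊠ (μᶜ·|·|_E^s)∘det_a`» -/
  PullbackIsSection : (V : CuspRep) → (μ : Char) → (a : ℕ) → StdSection μ a → Form V → ℂ → Prop
  /-- the value `∫_{G(F)\G(𝔸_F)} E_{P_a}(ι(g′,g); f^◇_{a,s}) φ(g) μ(det g) dg` (meromorphic in `s`) -/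
  doublingIntegral : (V : CuspRep) → (μ : Char) → (a : ℕ) → StdSection μ a → Form V → GaPts a → ℂ → ℂ
  /-- the value `E_{Q_a}(g′; f^{◇,φ}_{a,s})` (meromorphic in `s`) -/
  eisQPullback : (V : CuspRep) → (μ : Char) → (a : ℕ) → StdSection μ a → Form V → GaPts a → ℂ → ℂ
  /-- «the `f^{◇,φ}_{a,s}` (all `f^◇_{a,s}`, all `φ`) span the whole induced space at `s`» (Lem. B.12) -/
  PullbacksSpan : CuspRep → Char → ℕ → ℂ → Prop

namespace ThetaPoleProofDictionary

variable (X : ThetaPoleProofDictionary.{u})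

/-! ### Class D: definitions read off the print -/

/-- D (p. 98 L52, l. 4317: «suppose that `{E_Q(g; f_s) | f ∈ I(V_π ⊠ μᶜ)}` has the largest pole at `s_max`»; Prop. B.8, p. 100
L29: «Let `s₁` be the maximal positive real pole of `{E_Q(g; f_s) | f ∈ I(V_π ⊠ μᶜ)}`»; p. 101 L3: «`s₁` is the largest number in
`Pol_1(V_π ⊠ μᶜ)`»): `s` is the LARGEST POSITIVE REAL POLE of the Eisenstein family of `V_π ⊠ μᶜ` on `G_1`, i.e. the maximum
of `Pol_1(V_π ⊠ μᶜ)`. [cite: Liu2021, App. B §B.2 (p. 98 L52) and Prop. B.8 (p. 100 L29); FJcycle.tex l. 4317, 4362, 4372] -/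
def IsLargestPole (V : X.CuspRep) (μ : X.Char) (s : ℝ) : Prop :=
  s ∈ X.Pol V μ 1 ∧ ∀ t ∈ X.Pol V μ 1, t ≤ s

/-- D (p. 100 L50 – p. 101 L1, l. 4372: «In particular, `I_1(V_π ⊠ μᶜ) = I(V_π ⊠ μᶜ)`. Let `Pol_a(V_π ⊠ μᶜ)` be the set of positive
real poles of `E_{Q_a}(·; f_{a,s})`»): the level-`1` pole set of THIS dictionary is the set of positive real `s` at which the
family `{E_Q(g; f_s)}` of the parent dictionary has a pole (★ `ThetaPoleDictionary.EisPole`).  A compatibility predicate a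
consumer supplies with the dictionary (no propositional FIELD is posited). [cite: Liu2021, App. B §B.3 (p. 100 L50 – p. 101 L1); FJcycle.tex l. 4372] -/
def PolOneSpec : Prop :=
  ∀ (V : X.CuspRep) (μ : X.Char) (s : ℝ), s ∈ X.Pol V μ 1 ↔ 0 < s ∧ X.EisPole V μ (s : ℂ)

/-- D (hypothesis of Lem. B.10, p. 101 L56, l. 4399: «Suppose that `μ|𝔸_F^× = μ_{E/F}^i` for `i ∈ {0, 1}`»): `μ` is conjugate
orthogonal and `i = 0`, or conjugate symplectic and `i = 1` (Def. 4.1). [cite: Liu2021, Lem. B.10 (p. 101 L56) and Def. 4.1 (p. 41); FJcycle.tex l. 4399, 1901] -/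
def HasParity (μ : X.Char) (i : ℕ) : Prop :=
  (i = 0 ∧ X.IsConjOrthogonal μ) ∨ (i = 1 ∧ X.IsConjSymplectic μ)

/-! ### Class P: Cor. B.6 (2), (3), Rem. B.7 -/

/-- P. **Corollary B.6 (2)**, AS PRINTED (notation of p. 98 L52: `V_π` a cuspidal realization, `{E_Q(g; f_s)}` with largest pole
`s_max`, `W` THE skew-hermitian space of dimension `n + 1 − 2 s_max` with `Θ^W_{(μ,ν),V}(V_π) ≠ 0`; hypothesis of B.6: that lift is
cuspidal): «(2) The space `R_{s_max}(V_π ⊠ μᶜ)` generated by residues of `{E_Q(g; f_s) | f ∈ I(V_π ⊠ μᶜ)}` at `s = s_max` is an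
irreducible representation of `G_1(𝔸_F)`; and (B.3) `R_{s_max}(V_π ⊠ μᶜ) = Θ^{V_1}_{(μ⁻¹,ν⁻¹),−W}(Θ^W_{(μ,ν),V}(V_π))`.»  Proof in
print: constant terms + [Wu13, Prop. 5.9].  Used in the proof of Prop. 4.13, Case 2 (p. 48).  Nothing is asserted.
[cite: Liu2021, Cor. B.6 (2) (p. 99 L13–17); FJcycle.tex l. 4328–4331] [cite: Wu2013, Prop. 5.9] -/
def CorB6_2 : Prop :=
  ∀ (V : X.CuspRep) (μ : X.Char) (sMax : ℝ) (W : X.SkewHerm), X.IsLargestPole V μ sMax →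
    (X.dim W : ℝ) = X.n + 1 - 2 * sMax → X.ThetaNonzero V μ W → X.LiftCuspidal V μ W →
    X.ResIrreducible V μ sMax ∧ X.ResIsThetaLift V μ sMax W

/-- P. **Corollary B.6 (3), situation (1)**, AS PRINTED: «let `π_W` … be the underlying (irreducible) representation of
`Θ^W_{(μ,ν),V}(V_π)` … If `π_W` has a unique realization as a subquotient in the space of automorphic forms on `U(W)`, then
`m_cusp(π) = 1`» (`π` the underlying representation of `V_π`; same standing notation as `CorB6_2`).  Proof in print: theta
dichotomy [SZ15, Thm. 1.10], Howe duality [GT16, Thm. 1.2], [Wu13, Thm. 5.1].  Used in the proof of Prop. 4.13 (Cases 1 and 2: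
«`m_cusp(π) = 1`»).  Nothing is asserted. [cite: Liu2021, Cor. B.6 (3) (p. 99 L19–22); FJcycle.tex l. 4333] [cite: SunZhu2014, Thm. 1.10] [cite: Wu2013, Thm. 5.1] -/
def CorB6_3_cusp : Prop :=
  ∀ (V : X.CuspRep) (μ : X.Char) (sMax : ℝ) (W : X.SkewHerm), X.IsLargestPole V μ sMax →
    (X.dim W : ℝ) = X.n + 1 - 2 * sMax → X.ThetaNonzero V μ W → X.LiftCuspidal V μ W →
    X.LiftUniqueRealization V μ W → X.cuspMult V = 1

/-- P. **Corollary B.6 (3), situation (2)**, AS PRINTED: «let … `π₁` be the underlying (irreducible) representation of …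
`R_{s_max}(V_π ⊠ μᶜ)`. If `π_W` has a unique realization as a subquotient in the space of automorphic forms on `U(W)`, then …
`m_cusp(π₁) = 0`» (the residual representation has no cuspidal realization).  Proof in print: `L^S(s, π₁) = L^S(s, π)·L^S(s −
s_max, μᶜ)`, Thm. B.4 for `V_1`, theta dichotomy, Howe duality, [Wu13, Thm. 5.1], (B.3).  Nothing is asserted.
[cite: Liu2021, Cor. B.6 (3) (p. 99 L19–22; proof p. 99 L41 – p. 100 L20); FJcycle.tex l. 4333, 4347] -/
def CorB6_3_res : Prop :=
  ∀ (V : X.CuspRep) (μ : X.Char) (sMax : ℝ) (W : X.SkewHerm), X.IsLargestPole V μ sMax →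
    (X.dim W : ℝ) = X.n + 1 - 2 * sMax → X.ThetaNonzero V μ W → X.LiftCuspidal V μ W →
    X.LiftUniqueRealization V μ W → X.resCuspMult V μ sMax = 0

/-- P. **Remark B.7**, AS PRINTED: «In fact, in Corollary B.6, the space `Θ^W_{(μ,ν),V}(V_π)` is always cuspidal, which follows
from an analogous statement of [GJS09, Theorem 5.1], whose proof can be adopted to the unitary case as well. Since we do not
need this fact, we will leave the details to interested readers as an exercise.»  NOT proved in print (stated as an exercise);
typed as the implication «situation of Cor. B.6 ⇒ the lift to `W` is cuspidal».  Nothing is asserted.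
[cite: Liu2021, Rem. B.7 (p. 100 L22–25); FJcycle.tex l. 4351–4353] [cite: GinzburgJiangSoudry2009, Thm. 5.1] -/
def RemB7 : Prop :=
  ∀ (V : X.CuspRep) (μ : X.Char) (sMax : ℝ) (W : X.SkewHerm), X.IsLargestPole V μ sMax →
    (X.dim W : ℝ) = X.n + 1 - 2 * sMax → X.ThetaNonzero V μ W → X.LiftCuspidal V μ W

/-! ### Class P: §B.3 — Prop. B.8, Lem. B.9 – B.12 -/

/-- P. **Proposition B.8 (1)**, AS PRINTED: «Suppose that `μᶜ = μ⁻¹`» (= `μ` conjugate self-dual, Def. 4.1: trivial on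
`Nm_{𝔸_E/𝔸_F} 𝔸_E^×`; read through ★ `ThetaPoleDictionary.IsConjSelfDual` = orthogonal ∨ symplectic, the Remark after Def. 4.1).
«Let `s₁` be the maximal positive real pole of `{E_Q(g; f_s) | f ∈ I(V_π ⊠ μᶜ)}`. Then (1) There is some skew-hermitian space `W` of
dimension `n + 1 − 2s₁` such that `Θ^W_{(μ,ν),V}(V_π) ≠ 0`.»  «the unitary version of [GJS09, Theorem 3.1]».  Nothing is asserted.
[cite: Liu2021, Prop. B.8 (1) (p. 100 L29–32); FJcycle.tex l. 4361–4364] [cite: GinzburgJiangSoudry2009, Thm. 3.1] -/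
def PropB8_1 : Prop :=
  ∀ (V : X.CuspRep) (μ : X.Char) (s₁ : ℝ), X.IsConjSelfDual μ → X.IsLargestPole V μ s₁ →
    ∃ W : X.SkewHerm, (X.dim W : ℝ) = X.n + 1 - 2 * s₁ ∧ X.ThetaNonzero V μ W

/-- P. **Proposition B.8 (2)**, AS PRINTED (same hypotheses): «(2) All other positive real poles of `E_Q(g; f_s)` have the form
`s₁ − j` for some integer `j ≥ 0`.» [cite: Liu2021, Prop. B.8 (2) (p. 100 L33–34); FJcycle.tex l. 4366] -/
def PropB8_2 : Prop :=
  ∀ (V : X.CuspRep) (μ : X.Char) (s₁ : ℝ), X.IsConjSelfDual μ → X.IsLargestPole V μ s₁ →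
    ∀ s ∈ X.Pol V μ 1, ∃ j : ℕ, s = s₁ - j

/-- P. **Lemma B.9**, AS PRINTED: «Let `s₀` be an element in `Pol_1(V_π ⊠ μᶜ)` such that `s₀ + j ∉ Pol_1(V_π ⊠ μᶜ)` for every
integer `j > 0`. Then `s₀ + (a−1)/2` lies in `Pol_a(V_π ⊠ μᶜ)`.»  Typed for the tower index `a ≥ 1` (the lemma climbs the tower
`G_1 ⊂ G_a`; for `a = 0`, `Q_0 = G_0 = G` and there is no Eisenstein series — the print's «integer `a ≥ 0`» of l. 4372 is the
range of the NOTATION, the lemma is used at `a ≥ a₀` large, proof of Prop. B.8 l. 4466).  «the unitary analogue of [Mœg97,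
Remarque 1.1] and [GJS09, Proposition 1.1]».  Nothing is asserted.
[cite: Liu2021, Lem. B.9 (p. 101 L5–7); FJcycle.tex l. 4374–4376] -/
def LemB9 : Prop :=
  ∀ (V : X.CuspRep) (μ : X.Char) (s₀ : ℝ) (a : ℕ), 1 ≤ a → s₀ ∈ X.Pol V μ 1 →
    (∀ j : ℕ, 0 < j → s₀ + j ∉ X.Pol V μ 1) → s₀ + ((a : ℝ) - 1) / 2 ∈ X.Pol V μ a

/-- P. **Lemma B.10 (1)**, AS PRINTED (under «`μ|𝔸_F^× = μ_{E/F}^i` for `i ∈ {0,1}`», `HasParity`): «(1) The poles of the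
Siegel–hermitian Eisenstein series `E_{P_a}(·; f^◇_{a,s})` in the region `Re(s) > 0` are all simple, and are contained in the set
`{(n+a−i)/2, (n+a−i)/2 − 1, …}`.»  Proof in print: «Main Theorem of [Tan99]».  Nothing is asserted.
[cite: Liu2021, Lem. B.10 (1) (p. 101 L56 – p. 102 L9); FJcycle.tex l. 4398–4401] -/
def LemB10_1 : Prop :=
  ∀ (μ : X.Char) (i a : ℕ) (f : X.StdSection μ a) (s : ℂ), X.HasParity μ i → 0 < s.re → X.SiegelEisPole μ a f s →
    X.SiegelEisPoleSimple μ a f s ∧ ∃ k : ℕ, s = ((X.n : ℂ) + a - i) / 2 - k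

/-- P. **Lemma B.10 (2)**, AS PRINTED: «(2) The integral (B.4) is absolutely convergent for `Re(s) > (n+a)/2`.»
[cite: Liu2021, Lem. B.10 (2) (p. 102 L13); FJcycle.tex l. 4403] -/
def LemB10_2 : Prop :=
  ∀ (V : X.CuspRep) (μ : X.Char) (i a : ℕ) (f : X.StdSection μ a) (φ : X.Form V) (s : ℂ), X.HasParity μ i →
    ((X.n : ℝ) + a) / 2 < s.re → X.PullbackConverges V μ a f φ s

/-- P. **Lemma B.10 (3)**, AS PRINTED: «(3) The function `f^{◇,φ}_{a,s}` has a meromorphic continuation to the entire complex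
plane, whose possible poles in the region `Re(s) > 0` are contained in the set `{(n−i)/2, (n−i)/2 − 1, …}`.»  Proof in print:
[Mœg97, §2.1] and «Main Theorem of [Tan99]» (the poles of `f^{◇,φ}_{a,s}` are among those of `E_{P_0}(g; f_s|G(𝔸_F))`).
[cite: Liu2021, Lem. B.10 (3) (p. 102 L16–20); FJcycle.tex l. 4405] -/
def LemB10_3 : Prop :=
  ∀ (V : X.CuspRep) (μ : X.Char) (i a : ℕ) (f : X.StdSection μ a) (φ : X.Form V), X.HasParity μ i →
    X.PullbackMeromorphic V μ a f φ ∧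
      ∀ s : ℂ, 0 < s.re → X.PullbackPole V μ a f φ s → ∃ k : ℕ, s = ((X.n : ℂ) - i) / 2 - k

/-- P. **Lemma B.10 (4)**, AS PRINTED: «(4) If `s` is not a pole of `f^{◇,φ}_{a,s}`, then `f^{◇,φ}_{a,s}` is a section in the
normalized induced representation `Ind^{G_a(𝔸_F)}_{Q_a(𝔸_F)} V_π ⊠ (μᶜ·|·|_E^s)∘det_a`.» [cite: Liu2021, Lem. B.10 (4) (p. 102 L22–24); FJcycle.tex l. 4407] -/
def LemB10_4 : Prop :=
  ∀ (V : X.CuspRep) (μ : X.Char) (i a : ℕ) (f : X.StdSection μ a) (φ : X.Form V) (s : ℂ), X.HasParity μ i →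
    ¬ X.PullbackPole V μ a f φ s → X.PullbackIsSection V μ a f φ s

/-- P. **Lemma B.11**, AS PRINTED: «For a standard section `f^◇_{a,s} ∈ J_a(s, μᶜ)` and a cusp form `φ ∈ V_π`, we have the identity
`∫_{G(F)\G(𝔸_F)} E_{P_a}(ι(g′,g); f^◇_{a,s}) φ(g) μ(det g) dg = E_{Q_a}(g′; f^{◇,φ}_{a,s})` for `g′ ∈ G_a(𝔸_F)`, as meromorphic functions
in `s` away from the poles of `f^{◇,φ}_{a,s}`.»  Typed as the equality of the two posited values at every `g′` and every `s`
that is not a pole of `f^{◇,φ}_{a,s}`.  «analogous to [Mœg97, Proposition 2.1] and [GJS09, Proposition 3.3]».  Nothing is asserted.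
[cite: Liu2021, Lem. B.11 (p. 102 L37–42); FJcycle.tex l. 4417–4423] -/
def LemB11 : Prop :=
  ∀ (V : X.CuspRep) (μ : X.Char) (a : ℕ) (f : X.StdSection μ a) (φ : X.Form V) (g' : X.GaPts a) (s : ℂ),
    ¬ X.PullbackPole V μ a f φ s → X.doublingIntegral V μ a f φ g' s = X.eisQPullback V μ a f φ g' s

/-- P. **Lemma B.12**, AS PRINTED: «There exists an integer `a₀` depending only on `V_π` and `μ` such that for every integer
`a ≥ a₀`, if `s` is not a pole of `{f^{◇,φ}_{a,s}}`, then the functions `{f^{◇,φ}_{a,s}}` for all standard sections `f^◇_{a,s} ∈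
J_a(s, μᶜ)` and `φ ∈ V_π` span the whole space `Ind^{G_a(𝔸_F)}_{Q_a(𝔸_F)} V_π ⊠ (μᶜ·|·|_E^s)∘det_a`.»  «the same discussion after
[GJS09, Proposition 3.3]».  Nothing is asserted. [cite: Liu2021, Lem. B.12 (p. 103 L77–80); FJcycle.tex l. 4456–4458] -/
def LemB12 : Prop :=
  ∀ (V : X.CuspRep) (μ : X.Char), ∃ a₀ : ℕ, ∀ a : ℕ, a₀ ≤ a → ∀ s : ℂ,
    (∀ (f : X.StdSection μ a) (φ : X.Form V), ¬ X.PullbackPole V μ a f φ s) → X.PullbacksSpan V μ a s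

end ThetaPoleProofDictionary

end Literature.NumberTheory.Automorphic.Liu2021.AppendixB.PolesEisensteinThetaLifting

end
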